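/-
COR-CM (cell pub-hodgecm2, stage 2 of the Hodge ladder) — Δ2 bridge, (c)+(d) closure at ι₁ after the coordinator's ruling «WORLD = C»
(pub-hodgecm2/INBOX 2026-08-23 ≈23:30Z, item (4)): package P1 = the UNTWISTED Prop-C.5 datum («`X_K := M_K`, slot `(τ₁, ι₁)`»,
d2bridge-stmt g3), whose consumed slot at the TAUTOLOGICAL embedding `ι₁` is the chosen record's own complex fibre — the datum over which
the cofan along `ι₁` (hence `ComponentAlbanese` at instance `ι₁`) exists.  Seat prover-pub-hodgecm2-rekey-l0-instlevel-a-g1-0.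
DEFINITIONS + their unfolding lemmas + ONE theorem modulo the named fact `h : exists_recordSystem`; nothing asserted; nothing in the tree
edited or restated.  FRAMING: HC_CM is NOT proved; «Δ2 BRIDGE CLOSED» is NOT claimed.
-/
import Summits.HodgeConjecture.CorCM.B01.Transposition.HComp.HUnifEngine
import Summits.HodgeConjecture.CorCM.B01.Transposition.HComp.HonestP5Of
import HarnessLib

/-!
# TEAM hComp, package P1: the UNTWISTED honest Prop-C.5 datum `honestP5Id` and `hUnif` at `e := id`

`HComp/HonestP5.lean` (b25) builds `honestP5 V K₀ M` with the slot functor `K ↦ X_{K ⊓ K₀} ⊗_{F,τ'} τ'(F)`, `X_K := M_K ⊗_{F,c} F`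
(Liu's App.-C label `τ' = ῑ₁`: the consumed slot `(τ₁, ῑ₁)` is then `M_K ⊗_{F,ι₁} ℂ`, the record; `HUnifHolds.lean` = `hUnif` at
`e := conj ∘ ι₁`).  Under the coordinator's ruling «WORLD = C» (live `ι₁` keying = Liu verbatim; the App.-C `ῑ₁` label is unconsumed
bookkeeping) the (c)+(d) residual of the END closes at the LITERAL pin only over a cofan ALONG `ι₁`, i.e. over the untwisted datum
(d2bridge-stmt g3's P1, prove-8 ∕ pin-a ∕ this seat, INBOX l.≈12495–12506):

* §1 `honestP5Id V K₀ M : PropC5Data F⁺ F` — `honestP5` with `conjSystem M` replaced by `M` itself: `Sh τ τ' := K ↦ M_{K ⊓ K₀} ⊗_{F,τ'} τ'(F)`;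
  `honestSystemId` (Prop. C.5 CONSTRUCTED, `Sh𝕍 := M`), `propC5AsPrinted_honestP5Id`; levelwise readings `honestP5Id_Sh_transport_obj_iso`
  and, over `ℂ`, `honestP5Id_Sh_transport_obj_complexIso : slot (τ, τ') ⊗ ℂ ≅ M_K ⊗_{F,τ'} ℂ` (NO conjugation anywhere).
* §2 the TOTAL datum `honestP5IdOf h : ∀ F ι₁ V Φ, PropC5Data F⁺ F` (`:= honestP5Id V (K3 V) (recordFunctorOf h V)`, uniform in `F` exactly as
  `honestP5Of`), `honestP5IdOf_eq`, and the consumed slot `honestP5IdOf_slotIso : slot (τ, ι₁) ⊗ ℂ ≅ M_K ⊗_{F,ι₁} ℂ` (`K ≤ K_f(3)`, `4 ≤ [F:ℚ]`).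
* §3 **`hUnif_holds_id h`** — pin-1's binder `hUnif` VERBATIM at `e := fun _ ι₁ => ι₁`, `P5 := honestP5IdOf h`: the record's pieces
  (`RecordSystem.pieces`, tautological balls `(B c).Hℂ = V.Hm.map ι₁`, levels `HComp.Λ`) moved across `honestP5IdOf_slotIso` by the
  e-generic engine `hUnif_of_slotIso_of_pieces` — the same eight lines as `hUnif_holds`.

What this file does NOT do (W2′, the HComp lineage's): `Sec42Data` ∕ `sec42DataOf` ∕ `HeckeTranslates` ∕ (a)(b) pins ∕ F1–F5 ∕ `UniformOmega` ∕
`ComponentAlbanese` are typed over `honestP5Of`; re-instantiating them over `honestP5IdOf` (so that the e-generic cofan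
`AlbaneseOnPieceCofan.exists_treeCofan_X_baseChange_along` at `e := id` yields `J₁` at instance `ι₁`) is the sequel.  T5: n/a (carrier +
one theorem modulo `h`).  HC_CM is NOT proved.
-/

noncomputable section

namespace Summit.HodgeConjecture.CorCM.Model

open CategoryTheory CategoryTheory.Limits AlgebraicGeometry NumberField
open Literature.AlgebraicGeometry.Motives
open Literature.AlgebraicGeometry.ShimuraVarieties
open Literature.AlgebraicGeometry.ShimuraVarieties.UnitaryCanonicalModel
open Literature.NumberTheory.Automorphic
open Literature.NumberTheory.Automorphic.UnitaryGroup
open Literature.NumberTheory.Automorphic.PicardCM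
open Literature.NumberTheory.Automorphic.Liu2021
open Literature.NumberTheory.Automorphic.Liu2021.AppendixC
open Summit.HodgeConjecture.CorCM.HComp
open HComp

/-! ## §1  The untwisted datum `honestP5Id` -/

section P5

variable {F : CMField} {ι₁ : F →+* ℂ} (V : HermSpace3 F ι₁)
  (K₀ : C5.OpenCompactSubgroup ↥V.adelicFin) (M : C5.SmallLevel K₀ ⥤ SchemeOver F)

/-- **The UNTWISTED honest Prop-C.5 datum of `V`** built from a projective system `M : K ↦ M_K` of `F`-schemes on the open compact
`K ≤ K₀` (x1's canonical-model `RecordSystem …|>.M`): as `honestP5` (`n := 3`, `G := Gτ τ := U(V)(𝔸_{F⁺,f})`, `fix τ := refl`, the carrier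
tokens `𝕍`, `V τ`) but with the slot functor `Sh τ τ' := (K ↦ M_{K ⊓ K₀} ⊗_{F,τ'} τ'(F))` — `X_K := M_K`, NO twist by the complex
conjugation of `F` (package P1: the consumed slot is `(τ₁, ι₁)`, the TAUTOLOGICAL embedding).  Nothing is asserted: `PropC5Data` is a
carrier structure. [cite: Liu2021, App. C l. 4550, l. 4618–4624, Prop. C.5 l. 4627–4633] -/
abbrev honestP5Id : PropC5Data (maximalRealSubfield F) F where
  n := 3
  one_le_n := by norm_num
  𝕍 := Fin 3 → IsDedekindDomain.FiniteAdeleRing (𝓞 F) F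
  G := ↥V.adelicFin
  V := fun _ => Fin 3 → F
  Gτ := fun _ => ↥V.adelicFin
  fix := fun _ => ContinuousMulEquiv.refl _
  Sh := fun _ τ' => restrictFunctor K₀ ⋙ M ⋙ C5.baseChangeAlong τ'.rangeRestrictField

/-- `honestP5Id.n = 3`. [cite: Liu2021, App. C l. 4618] -/
@[simp] theorem honestP5Id_n : (honestP5Id V K₀ M).n = 3 := rfl

/-- The fixed isomorphism of `honestP5Id` is the identity. [cite: Liu2021, App. C l. 4624] -/
@[simp] theorem honestP5Id_fix (τ : maximalRealSubfield F →+* ℝ) :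
    (honestP5Id V K₀ M).fix τ = ContinuousMulEquiv.refl _ := rfl

/-- The Shimura-variety slots of `honestP5Id`: `K ↦ M_{K ⊓ K₀} ⊗_{F,τ'} τ'(F)`. [cite: Liu2021, Prop. C.5 l. 4627–4633] -/
theorem honestP5Id_Sh (τ : maximalRealSubfield F →+* ℝ) (τ' : F →+* ℂ) :
    (honestP5Id V K₀ M).Sh τ τ' = restrictFunctor K₀ ⋙ M ⋙ C5.baseChangeAlong τ'.rangeRestrictField := rfl

/-- The Shimura-variety slots of `honestP5Id` on objects. [cite: Liu2021, Prop. C.5 l. 4627–4633] -/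
@[simp] theorem honestP5Id_Sh_obj (τ : maximalRealSubfield F →+* ℝ) (τ' : F →+* ℂ)
    (K : C5.OpenCompactSubgroup ↥V.adelicFin) :
    ((honestP5Id V K₀ M).Sh τ τ').obj K =
      (C5.baseChangeAlong τ'.rangeRestrictField).obj (M.obj (restrictLevel K₀ K)) := rfl

/-- **The system of Shimura varieties (Def. C.6) on `honestP5Id`, with Prop. C.5's isomorphisms CONSTRUCTED**: threshold `K₀`,
`Sh(𝕍)_K := M_K`, and for every real `τ` and every `τ'` above it the isomorphism of projective systems given by the index isomorphism
`refl(K) ⊓ K₀ = K` whiskered through `M_· ⊗_{F,τ'} τ'(F)` (as `honestSystem`, untwisted). [cite: Liu2021, Prop. C.5 l. 4627–4633 and Def. C.6 l. 4640–4642] -/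
abbrev honestSystemId : IncoherentShimuraSystem (honestP5Id V K₀ M) where
  K₀ := K₀
  Sh𝕍 := M
  iso _ τ' _ :=
    (Functor.leftUnitor (M ⋙ C5.baseChangeAlong τ'.rangeRestrictField)).symm ≪≫
      Functor.isoWhiskerRight (transportRestrictIso K₀).symm (M ⋙ C5.baseChangeAlong τ'.rangeRestrictField) ≪≫
      Functor.associator _ _ _

/-- The threshold of `honestSystemId` is `K₀`. [cite: Liu2021, Prop. C.5 l. 4627–4628] -/
@[simp] theorem honestSystemId_K₀ : (honestSystemId V K₀ M).K₀ = K₀ := rfl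

/-- `honestSystemId.Sh𝕍 = M`. [cite: Liu2021, Def. C.6 l. 4640–4642] -/
@[simp] theorem honestSystemId_Sh𝕍 : (honestSystemId V K₀ M).Sh𝕍 = M := rfl

/-- **Prop. C.5 holds for `honestP5Id`, by construction.** [cite: Liu2021, Prop. C.5 l. 4627–4633] -/
theorem propC5AsPrinted_honestP5Id : PropC5AsPrinted (honestP5Id V K₀ M) :=
  (propC5AsPrinted_iff _).2 ⟨honestSystemId V K₀ M⟩

/-- **Levelwise: `honestP5Id.Sh τ τ'` at a transported level `K ≤ K₀` is `M_K ⊗_{F,τ'} τ'(F)`** (the re-indexing isomorphism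
`refl(K) ⊓ K₀ = K` pushed through `M_· ⊗_{F,τ'} τ'(F)`). [cite: Liu2021, Prop. C.5 l. 4627–4633] -/
def honestP5Id_Sh_transport_obj_iso (τ : maximalRealSubfield F →+* ℝ) (τ' : F →+* ℂ) (K : C5.OpenCompactSubgroup ↥V.adelicFin)
    (hK : K ≤ K₀) :
    ((honestP5Id V K₀ M).Sh τ τ').obj (C5.OpenCompactSubgroup.transport ((honestP5Id V K₀ M).fix τ) K) ≅
      (C5.baseChangeAlong τ'.rangeRestrictField).obj (M.obj ⟨K, hK⟩) :=
  (M ⋙ C5.baseChangeAlong τ'.rangeRestrictField).mapIso (restrictTransportIso K₀ K hK)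

/-- **Over `ℂ`: the slot `(τ, τ')` of `honestP5Id` at `K ≤ K₀` is `M_K ⊗_{F,τ'} ℂ`** — base-change transitivity
`(M_K ⊗_{τ'} τ'(F)) ⊗ ℂ ≅ M_K ⊗_{τ'} ℂ` (Görtz–Wedhorn Prop. 4.16, tree `baseChangeHomObjIsoOfComp`); NO conjugation.
[cite: GortzWedhorn2020, Prop. 4.16 and §(4.7)] [cite: Liu2021, Prop. C.5 l. 4630] -/
def honestP5Id_Sh_transport_obj_complexIso (τ : maximalRealSubfield F →+* ℝ) (τ' : F →+* ℂ)
    (K : C5.OpenCompactSubgroup ↥V.adelicFin) (hK : K ≤ K₀) :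
    (baseChangeHom τ'.fieldRange.subtype).obj
        (((honestP5Id V K₀ M).Sh τ τ').obj (C5.OpenCompactSubgroup.transport ((honestP5Id V K₀ M).fix τ) K)) ≅
      (baseChangeHom τ').obj (M.obj ⟨K, hK⟩) :=
  (baseChangeHom τ'.fieldRange.subtype).mapIso (honestP5Id_Sh_transport_obj_iso V K₀ M τ τ' K hK) ≪≫
    baseChangeHomObjIsoOfComp τ'.rangeRestrictField τ'.fieldRange.subtype τ'
      (RingHom.ext fun _ => rfl : (τ'.fieldRange.subtype).comp τ'.rangeRestrictField = τ') _

end P5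

/-! ## §2  The total untwisted datum `honestP5IdOf` and its consumed slot `(τ₁, ι₁)` -/

section Total

/- `h : exists_recordSystem` is an explicit per-declaration binder below (no section `variable` carrying a named Prop). -/

/-- **`Model.honestP5IdOf h` — the untwisted honest Prop-C.5 datum as a TOTAL function of `(F, ι₁, V, Φ)`**:
`honestP5Id V (K3 V) (recordFunctorOf h V)`, uniform in `F` exactly as `honestP5Of` (the only case split `4 ≤ [F:ℚ]` is inside the record
functor).  CONDITIONAL on the named fact `h`; HC_CM is NOT proved; `Φ` is not read. [cite: Liu2021, App. C l. 4618–4624 and Prop. C.5 l. 4627–4633]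
[cite: Deligne1979ShimuraVarieties, 2.2.5 and Cor. 2.7.21] -/
abbrev honestP5IdOf (h : exists_recordSystem) : ∀ (F : CMField) (ι₁ : F →+* ℂ) (V : HermSpace3 F ι₁) (_ : Literature.AlgebraicGeometry.Motives.CMType F),
    PropC5Data (maximalRealSubfield F) F :=
  fun _ _ V _ => honestP5Id V (K3 V) (recordFunctorOf h V)

variable {F : CMField} {ι₁ : F →+* ℂ}

/-- `(honestP5IdOf h F ι₁ V Φ).G = U(V)(𝔸_{F⁺,f})` by `rfl`. [cite: Liu2021, App. C l. 4618] -/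
theorem honestP5IdOf_G (h : exists_recordSystem) (V : HermSpace3 F ι₁) (Φ : Literature.AlgebraicGeometry.Motives.CMType F) :
    (honestP5IdOf h F ι₁ V Φ).G = ↥V.adelicFin := rfl

/-- `(honestP5IdOf h F ι₁ V Φ).fix τ = refl`. [cite: Liu2021, App. C l. 4624] -/
theorem honestP5IdOf_fix (h : exists_recordSystem) (V : HermSpace3 F ι₁) (Φ : Literature.AlgebraicGeometry.Motives.CMType F)
    (τ : maximalRealSubfield F →+* ℝ) :
    (honestP5IdOf h F ι₁ V Φ).fix τ = ContinuousMulEquiv.refl _ := rfl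

/-- Under the guard `4 ≤ [F:ℚ]`, `honestP5IdOf h F ι₁ V Φ = honestP5Id V (K3 V) (recordOf h V h4).M`. [cite: Liu2021, Prop. C.5 l. 4627–4633] -/
theorem honestP5IdOf_eq (h : exists_recordSystem) (V : HermSpace3 F ι₁) (Φ : Literature.AlgebraicGeometry.Motives.CMType F)
    (h4 : 4 ≤ Module.finrank ℚ F) :
    honestP5IdOf h F ι₁ V Φ = honestP5Id V (K3 V) (recordOf h V h4).M :=
  congrArg (honestP5Id V (K3 V)) (recordFunctorOf_eq h V h4)

/-- **Prop. C.5 holds for `honestP5IdOf h F ι₁ V Φ`, by construction.** [cite: Liu2021, Prop. C.5 l. 4627–4633] -/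
theorem propC5AsPrinted_honestP5IdOf (h : exists_recordSystem) (V : HermSpace3 F ι₁)
    (Φ : Literature.AlgebraicGeometry.Motives.CMType F) : PropC5AsPrinted (honestP5IdOf h F ι₁ V Φ) :=
  propC5AsPrinted_honestP5Id V (K3 V) (recordFunctorOf h V)

/-- **The consumed slot of the untwisted TOTAL datum: over `ℂ`, `(honestP5IdOf h …).Sh τ ι₁` at `K ≤ K_f(3)` is the chosen record's
complex fibre `M_K ⊗_{F,ι₁} ℂ`**, `M_K := (recordOf h V h4).M.obj ⟨K, hK⟩` (§1 at `M := recordFunctorOf h V`, then `recordFunctorOf_objIso`);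
the slot is read at the TAUTOLOGICAL embedding `ι₁` — no `c`, no `ῑ₁`. [cite: Liu2021, Prop. C.5 l. 4627–4633] [cite: GortzWedhorn2020, Prop. 4.16] -/
def honestP5IdOf_slotIso (h : exists_recordSystem) (V : HermSpace3 F ι₁) (Φ : Literature.AlgebraicGeometry.Motives.CMType F)
    (h4 : 4 ≤ Module.finrank ℚ F) (τ : maximalRealSubfield F →+* ℝ)
    (K : C5.OpenCompactSubgroup ↥V.adelicFin) (hK : K ≤ K3 V) :
    (baseChangeHom ι₁.fieldRange.subtype).obj
        (((honestP5IdOf h F ι₁ V Φ).Sh τ ι₁).obj (C5.OpenCompactSubgroup.transport ((honestP5IdOf h F ι₁ V Φ).fix τ) K)) ≅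
      (baseChangeHom ι₁).obj ((recordOf h V h4).M.obj ⟨K, hK⟩) :=
  honestP5Id_Sh_transport_obj_complexIso V (K3 V) (recordFunctorOf h V) τ ι₁ K hK ≪≫
    (baseChangeHom ι₁).mapIso (recordFunctorOf_objIso h V h4 ⟨K, hK⟩)

end Total

/-! ## §3  `hUnif` at `e := id` for the untwisted datum -/

/-- **`hUnif` HOLDS at the untwisted datum `honestP5IdOf h`, pin `ι₁` (`e := id`)** — the binder `hUnif` of
`Model.hComp_of_unif_of_alb_along` token for token at `e := fun _ ι₁ => ι₁`, `P5 := honestP5IdOf h`, CONDITIONAL on the named fact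
`h : exists_recordSystem` ([Deligne 1979] 2.2.5 + Cor. 2.7.21).  Per face: `4 ≤ [F:ℚ]` from `6 ≤ [F:ℚ]`; `Ksm := K_f(3)`; for `K ≤ K_f(3)`:
`Y := M_K ⊗_{F,ι₁} ℂ` via `honestP5IdOf_slotIso`, pieces `(recordOf h V h4).pieces ⟨K, hK⟩` (tautological balls of `V^{ι₁}`), `Cset := Ξ_K`
(`finite_shimuraIndex`), `Γ q := HComp.Λ V K hK (g q)`, engine `hUnif_of_slotIso_of_pieces` — the proof of `hUnif_holds` with the one slot
isomorphism exchanged.  HC_CM is NOT proved.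
[cite: Deligne1979ShimuraVarieties, §2.1.2, 2.2.5 and Cor. 2.7.21] [cite: Liu2021, Prop. C.5 (FJcycle.tex l. 4627–4633)] -/
theorem hUnif_holds_id (h : exists_recordSystem) :
    ∀ (F : CMField), IsGalois ℚ F → 6 ≤ Module.finrank ℚ F → ∀ (Φ : CMType F) (ι₁ : F →+* ℂ), ι₁ ∈ Φ.1 →
      ∀ (V : HermSpace3 F ι₁) (τ : maximalRealSubfield F →+* ℝ), C5.IsAbove τ ι₁ →
        ∃ Ksm : Subgroup (honestP5IdOf h F ι₁ V Φ).G, IsOpenCompact Ksm ∧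
          ∀ K : C5.OpenCompactSubgroup (honestP5IdOf h F ι₁ V Φ).G, K.1 ≤ Ksm →
            ∃ (Cset : Type) (_ : Fintype Cset) (X : Cset → SchemeOver ℂ) (B : ∀ c, UnitaryBallUniformisationDatum 2 (X c))
              (Γ : Cset → Level V)
              (inj : ∀ c, X c ⟶ (baseChangeHom ι₁.fieldRange.subtype).obj
                (((honestP5IdOf h F ι₁ V Φ).Sh τ ι₁).obj (C5.OpenCompactSubgroup.transport ((honestP5IdOf h F ι₁ V Φ).fix τ) K))),
              (∀ c, (B c).Hℂ = V.Hm.map ι₁) ∧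
              (∀ c, (B c).Γ.map (Matrix.GeneralLinearGroup.map (B c).τ₁) =
                (Γ c).Γ.map (Matrix.GeneralLinearGroup.map ι₁)) ∧
              Nonempty (IsColimit (Cofan.mk _ inj)) := by
  refine hUnif_of_slotIso_of_pieces (fun _ ι₁ => ι₁) (honestP5IdOf h) ?_
  intro F _ h6 Φ ι₁ _ V τ _
  have h4 : 4 ≤ Module.finrank ℚ F := by omega
  refine ⟨(K3 V).1, (K3 V).2, fun K hK => ?_⟩
  obtain ⟨g, -, X, ι, hcol, B, hB⟩ := (recordOf h V h4).pieces ⟨K, hK⟩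
  haveI := finite_shimuraIndex V h4 (K.1 : Subgroup V.adelicFin) K.2.1
  exact ⟨_, honestP5IdOf_slotIso h V Φ h4 τ K hK, _, Fintype.ofFinite _, X, ι, hcol, B,
    fun q => HComp.Λ V K hK (g q), fun q => ⟨(hB q).1, (hB q).2.1⟩⟩

end Summit.HodgeConjecture.CorCM.Model

end
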